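import Summits.AtomisticToContinuum.Crystallization.Theorems.ChartedZeroExcessLayeredLatticeLiouvilleZQ

/-!
# Part ZR «Parallel up to re-parametrisation» (lens-2 g79, NODE 79 rider; sequel of `…LatticeLiouvilleZQ`)

`IsParallelReg` (part ZP) is a property of the crystal's GIVEN parametrisation `(L', w')`, while every binder of (L2-C) and its conclusion see
`(L', w')` only through the SET `LayeredHom L' w'` (`IsCoolShadowCrystal`: separation, environments, REG-out / REG-in of `placedCrystal`; `LinChartConcl`:
a chart of `placedCrystal`).  Hence the parallel case extends FOR FREE to every configuration whose crystal set ADMITS a parallel parametrisation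
(`IsReparallel`): ★ `repar_of_parallel` — (L2-C∥) ⟹ (L2-C∥′) `CoolShadowLinearChartReparP` at every parameter (PROVED, formal), so (L2-C∥′) is a THEOREM at
the record (`coolShadowLinearChart_repar_record`).  This removes from the open oblique piece the redundant presentations of regime (I) of the memo —
coincident layer planes, `ℤc₁ + ℤc₂` a proper sublattice of the layer lattice (index-2 rectangular presentations of triangular layers, …) — whenever the
crystal set itself is a parallel layered crystal.

★★ THE SMALLER OPEN PIECE (L2-C⟂′) `CoolShadowLinearChartSkewP`: non-empty container and NO parametrisation of the crystal set is parallel-registered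
(`¬ IsReparallel`).  `skew_of_oblique`: (L2-C⟂) ⟹ (L2-C⟂′) (the skew piece is WEAKER); EQUIV (L2-C≠∅) ⟺ (L2-C∥′) ∧ (L2-C⟂′) (`nonempty_iff_repar_skew`);
★★★ junction of record `bondLabelP_record_of_skew`: (GL) ⟸ (L2-S)(14, 57/4, 82/5) ∧ (L2-C⟂′)(82/5, 821/50, 1/100);
`skew_record_of_coolShadowLinearChartP_record`: NODE 78's record (L2-C)(82/5, 33/2, 1/100) implies the new open piece; `oblique_of_parallel_skew` and
`oblique_record_iff_skew_record`: at the record (L2-C⟂) ⟺ (L2-C⟂′).  0 sorry; standard axioms.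
-/

noncomputable section
open scoped BigOperators Classical InnerProductSpace RealInnerProductSpace
open MeasureTheory Set Metric Filter Topology
open Summit.AtomisticToContinuum.Crystallization.Theorems.ChartedPlanarOrderRigidityDoor (E3 IsClean IsCharted)
open Summit.AtomisticToContinuum.Crystallization.Theorems.ChartedPlanarOrderDensityDichotomy (μS IsSep)
open Summit.AtomisticToContinuum.Crystallization.Theorems.ChartedPlanarOrderCleanScaleP (IsCleanP IsDoorSetP isCleanP_one_iff isCleanP_μS_iff)
open Summit.AtomisticToContinuum.Crystallization.Theorems.ChartedPlanarOrderMesoCut (LayeredHom EnvClose)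
open Summit.AtomisticToContinuum.Crystallization.Theorems.ChartedPlanarOrderDoorLayeredOsc (IsTwoShellAffineGood mem_iff_μS_singleton_ne_zero)
open Literature.MathematicalPhysics.StatisticalMechanics (lennardJones triangularVec₁ triangularVec₂)
open Literature.Geometry.DiscreteGeometry (IsTwoShellGoodSet)

namespace Summit.AtomisticToContinuum.Crystallization.Theorems.ChartedZeroExcessLayeredLatticeLiouville

/-! ## ZR-1  Re-parametrisation invariance -/

/-- ★ the crystal SET admits a parallel-registered parametrisation. -/
def IsReparallel (ε r ℓ : ℝ) (S K : Set E3) (Ψ : ℤ × ℤ × ℤ → E3) (L' : E3 →L[ℝ] E3) (w' : ℤ → E3) (U : E3 ≃ₗᵢ[ℝ] E3) (t : E3) : Prop :=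
  ∃ (L'' : E3 →L[ℝ] E3) (w'' : ℤ → E3), LayeredHom L'' w'' = LayeredHom L' w' ∧ IsParallelReg ε r ℓ S K Ψ L'' w'' U t

/-- a parallel registration is a re-parallel one. [formal bookkeeping] -/
theorem IsParallelReg.isReparallel {ε r ℓ : ℝ} {S K : Set E3} {Ψ : ℤ × ℤ × ℤ → E3} {L' : E3 →L[ℝ] E3} {w' : ℤ → E3} {U : E3 ≃ₗᵢ[ℝ] E3}
    {t : E3} (h : IsParallelReg ε r ℓ S K Ψ L' w' U t) : IsReparallel ε r ℓ S K Ψ L' w' U t :=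
  ⟨L', w', rfl, h⟩

/-- equal layered sets place to equal crystals. [formal bookkeeping] -/
theorem placedCrystal_congr {L' L'' : E3 →L[ℝ] E3} {w' w'' : ℤ → E3} (h : LayeredHom L'' w'' = LayeredHom L' w') (U : E3 ≃ₗᵢ[ℝ] E3) (t : E3) :
    placedCrystal L'' w'' U t = placedCrystal L' w' U t := by
  unfold placedCrystal; rw [h]

/-- the cool-shadow-crystal class depends on the parametrisation only through the layered set. [formal bookkeeping] -/
theorem isCoolShadowCrystal_congr {σ ϑr Rs ε r rI ℓ : ℝ} {S K H : Set E3} {L' L'' : E3 →L[ℝ] E3} {w' w'' : ℤ → E3} {U : E3 ≃ₗᵢ[ℝ] E3} {t : E3}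
    (h : LayeredHom L'' w'' = LayeredHom L' w') (hcr : IsCoolShadowCrystal σ ϑr Rs ε r rI ℓ S K H L' w' U t) :
    IsCoolShadowCrystal σ ϑr Rs ε r rI ℓ S K H L'' w'' U t := by
  unfold IsCoolShadowCrystal at hcr ⊢
  rw [h, placedCrystal_congr h]
  exact hcr

/-- the conclusion of (L2-C) depends on the parametrisation only through the layered set. [formal bookkeeping] -/
theorem linChartConcl_congr {ε r ℓ R₁ RC η : ℝ} {S K : Set E3} {x₀ : E3} {Ψ : ℤ × ℤ × ℤ → E3} {L' L'' : E3 →L[ℝ] E3} {w' w'' : ℤ → E3}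
    {U : E3 ≃ₗᵢ[ℝ] E3} {t : E3} (h : LayeredHom L'' w'' = LayeredHom L' w') (hc : LinChartConcl ε r ℓ R₁ RC η S K x₀ Ψ L'' w'' U t) :
    LinChartConcl ε r ℓ R₁ RC η S K x₀ Ψ L' w' U t := by
  unfold LinChartConcl at hc ⊢
  rw [← placedCrystal_congr h]
  exact hc

/-! ## ZR-2  The pieces and the junction -/

/-- ★ (L2-C∥′) PARALLEL UP TO RE-PARAMETRISATION [PROVED below]: non-empty container, the crystal set admits a parallel-registered parametrisation. -/
def CoolShadowLinearChartReparP (ϑc ϑp r q rsh rm σ ϑr Rs ε rI ℓ aHi Λ θ s R₁ RC η : ℝ) : Prop :=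
  CoolShadowLinearChartUnderP (fun S K Ψ L' w' U t => K.Nonempty ∧ IsReparallel ε r ℓ S K Ψ L' w' U t)
    ϑc ϑp r q rsh rm σ ϑr Rs ε rI ℓ aHi Λ θ s R₁ RC η

/-- ★★ (L2-C⟂′) THE SKEW CASE [open, the smaller open piece]: non-empty container and NO parametrisation of the crystal set is parallel-registered —
transverse layers, or parallel layers that are not single cosets of one lattice (wobbly / imprimitive unions). -/
def CoolShadowLinearChartSkewP (ϑc ϑp r q rsh rm σ ϑr Rs ε rI ℓ aHi Λ θ s R₁ RC η : ℝ) : Prop :=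
  CoolShadowLinearChartUnderP (fun S K Ψ L' w' U t => K.Nonempty ∧ ¬ IsReparallel ε r ℓ S K Ψ L' w' U t)
    ϑc ϑp r q rsh rm σ ϑr Rs ε rI ℓ aHi Λ θ s R₁ RC η

/-- ★★ **(L2-C∥) ⟹ (L2-C∥′) (PROVED, formal)**: run the parallel case on the parallel parametrisation of the same set and transport binders and
conclusion along the set equality. [this file] -/
theorem repar_of_parallel {ϑc ϑp r q rsh rm σ ϑr Rs ε rI ℓ aHi Λ θ s R₁ RC η : ℝ}
    (hP : CoolShadowLinearChartParallelP ϑc ϑp r q rsh rm σ ϑr Rs ε rI ℓ aHi Λ θ s R₁ RC η) :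
    CoolShadowLinearChartReparP ϑc ϑp r q rsh rm σ ϑr Rs ε rI ℓ aHi Λ θ s R₁ RC η := by
  intro δ hδ a ha S hSd hsum hgood L w hL x₀ K hKS hKq hTp hTc L' w' U t hcr Ψ τ hΨ hsurj hcase
  obtain ⟨hne, L'', w'', hEq, hpar⟩ := hcase
  exact linChartConcl_congr hEq
    (hP δ hδ a ha S hSd hsum hgood L w hL x₀ K hKS hKq hTp hTc L'' w'' U t (isCoolShadowCrystal_congr hEq hcr) Ψ τ hΨ hsurj ⟨hne, hpar⟩)

/-- (L2-C⟂) ⟹ (L2-C⟂′): the skew piece is WEAKER than the oblique piece. [formal bookkeeping] -/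
theorem skew_of_oblique {ϑc ϑp r q rsh rm σ ϑr Rs ε rI ℓ aHi Λ θ s R₁ RC η : ℝ}
    (hO : CoolShadowLinearChartObliqueP ϑc ϑp r q rsh rm σ ϑr Rs ε rI ℓ aHi Λ θ s R₁ RC η) :
    CoolShadowLinearChartSkewP ϑc ϑp r q rsh rm σ ϑr Rs ε rI ℓ aHi Λ θ s R₁ RC η :=
  under_mono_case (fun S K Ψ L' w' U t (hQ : K.Nonempty ∧ ¬ IsReparallel ε r ℓ S K Ψ L' w' U t) =>
    ⟨hQ.1, fun hpar => hQ.2 hpar.isReparallel⟩) hO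

/-- ★★ JUNCTION (PROVED): (L2-C≠∅) ⟸ (L2-C∥′) ∧ (L2-C⟂′). [this file] -/
theorem nonempty_of_repar_skew {ϑc ϑp r q rsh rm σ ϑr Rs ε rI ℓ aHi Λ θ s R₁ RC η : ℝ}
    (hR : CoolShadowLinearChartReparP ϑc ϑp r q rsh rm σ ϑr Rs ε rI ℓ aHi Λ θ s R₁ RC η)
    (hS : CoolShadowLinearChartSkewP ϑc ϑp r q rsh rm σ ϑr Rs ε rI ℓ aHi Λ θ s R₁ RC η) :
    CoolShadowLinearChartNonemptyP ϑc ϑp r q rsh rm σ ϑr Rs ε rI ℓ aHi Λ θ s R₁ RC η := by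
  intro δ hδ a ha S hSd hsum hgood L w hL x₀ K hKS hKq hTp hTc L' w' U t hcr Ψ τ hΨ hsurj hne
  by_cases h : IsReparallel ε r ℓ S K Ψ L' w' U t
  · exact hR δ hδ a ha S hSd hsum hgood L w hL x₀ K hKS hKq hTp hTc L' w' U t hcr Ψ τ hΨ hsurj ⟨hne, h⟩
  · exact hS δ hδ a ha S hSd hsum hgood L w hL x₀ K hKS hKq hTp hTc L' w' U t hcr Ψ τ hΨ hsurj ⟨hne, h⟩

/-- ★★ EQUIV LAYER: (L2-C≠∅) ⟺ (L2-C∥′) ∧ (L2-C⟂′). [this file] -/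
theorem nonempty_iff_repar_skew (ϑc ϑp r q rsh rm σ ϑr Rs ε rI ℓ aHi Λ θ s R₁ RC η : ℝ) :
    CoolShadowLinearChartNonemptyP ϑc ϑp r q rsh rm σ ϑr Rs ε rI ℓ aHi Λ θ s R₁ RC η ↔
      CoolShadowLinearChartReparP ϑc ϑp r q rsh rm σ ϑr Rs ε rI ℓ aHi Λ θ s R₁ RC η ∧
        CoolShadowLinearChartSkewP ϑc ϑp r q rsh rm σ ϑr Rs ε rI ℓ aHi Λ θ s R₁ RC η :=
  ⟨fun h =>
      ⟨under_mono_case (fun S K Ψ L' w' U t (hQ : K.Nonempty ∧ IsReparallel ε r ℓ S K Ψ L' w' U t) => hQ.1) h,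
        under_mono_case (fun S K Ψ L' w' U t (hQ : K.Nonempty ∧ ¬ IsReparallel ε r ℓ S K Ψ L' w' U t) => hQ.1) h⟩,
    fun h => nonempty_of_repar_skew h.1 h.2⟩

/-- (L2-C⟂) ⟸ (L2-C∥) ∧ (L2-C⟂′): beneath the oblique piece, the skew piece is what is left once the parallel case is known. [this file] -/
theorem oblique_of_parallel_skew {ϑc ϑp r q rsh rm σ ϑr Rs ε rI ℓ aHi Λ θ s R₁ RC η : ℝ}
    (hP : CoolShadowLinearChartParallelP ϑc ϑp r q rsh rm σ ϑr Rs ε rI ℓ aHi Λ θ s R₁ RC η)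
    (hS : CoolShadowLinearChartSkewP ϑc ϑp r q rsh rm σ ϑr Rs ε rI ℓ aHi Λ θ s R₁ RC η) :
    CoolShadowLinearChartObliqueP ϑc ϑp r q rsh rm σ ϑr Rs ε rI ℓ aHi Λ θ s R₁ RC η :=
  ((nonempty_iff_parallel_oblique ϑc ϑp r q rsh rm σ ϑr Rs ε rI ℓ aHi Λ θ s R₁ RC η).1
    (nonempty_of_repar_skew (repar_of_parallel hP) hS)).2

/-! ## ZR-3  At the record -/

/-- ★★ (L2-C∥′) AT THE RECORD (PROVED). [this file] -/
theorem coolShadowLinearChart_repar_record (ϑc : ℝ) :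
    CoolShadowLinearChartReparP ϑc (1 / 10) 8 4 12 16 (17 / 20) (1 / 10000) 5 (1 / 10000) 10 (43 / 2) 1 2 (1 / 16) (1 / 50) (82 / 5) (821 / 50) (1 / 100) :=
  repar_of_parallel (coolShadowLinearChart_parallel_record ϑc)

/-- ★★★ **JUNCTION OF RECORD, SKEW FORM (PROVED)**: (GL) `BondLabelP` ⟸ (L2-S) `DoorChartPinningP … 14 (57/4) (82/5)` [open, NODE 78] ∧ (L2-C⟂′)
`CoolShadowLinearChartSkewP … (82/5) (821/50) (1/100)` [open, weaker than (L2-C⟂)]. [this file] -/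
theorem bondLabelP_record_of_skew (ϑc : ℝ)
    (hPin : DoorChartPinningP ϑc (1 / 10) 8 4 12 16 (17 / 20) (1 / 10000) 5 (1 / 10000) 10 (43 / 2) 1 2 (1 / 16) (1 / 50)
      14 (57 / 4) (82 / 5))
    (hS : CoolShadowLinearChartSkewP ϑc (1 / 10) 8 4 12 16 (17 / 20) (1 / 10000) 5 (1 / 10000) 10 (43 / 2) 1 2 (1 / 16) (1 / 50)
      (82 / 5) (821 / 50) (1 / 100)) :
    BondLabelP ϑc (1 / 10) 8 4 12 16 (17 / 20) (1 / 10000) 5 (1 / 10000) 10 (43 / 2) 1 2 (1 / 16) (1 / 50) :=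
  bondLabelP_of_pinning_linearChart_nonempty (RC := 821 / 50) (η := 1 / 100) (by norm_num) (by norm_num) (by norm_num) (by norm_num) (by norm_num)
    (by norm_num) (by norm_num) hPin (nonempty_of_repar_skew (coolShadowLinearChart_repar_record ϑc) hS)

/-- the skew piece at `RC' = 821/50` follows from NODE 78's record (L2-C)(82/5, 33/2, 1/100). [formal bookkeeping] -/
theorem skew_record_of_coolShadowLinearChartP_record (ϑc : ℝ)
    (h : CoolShadowLinearChartP ϑc (1 / 10) 8 4 12 16 (17 / 20) (1 / 10000) 5 (1 / 10000) 10 (43 / 2) 1 2 (1 / 16) (1 / 50)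
      (82 / 5) (33 / 2) (1 / 100)) :
    CoolShadowLinearChartSkewP ϑc (1 / 10) 8 4 12 16 (17 / 20) (1 / 10000) 5 (1 / 10000) 10 (43 / 2) 1 2 (1 / 16) (1 / 50)
      (82 / 5) (821 / 50) (1 / 100) :=
  skew_of_oblique (oblique_record_of_coolShadowLinearChartP_record ϑc h)

/-- ★ AT THE RECORD THE TWO OPEN FORMS AGREE: (L2-C⟂)(82/5, 821/50, 1/100) ⟺ (L2-C⟂′)(82/5, 821/50, 1/100) — so either may be booked; the skew form names the
smaller configuration class. [this file] -/
theorem oblique_record_iff_skew_record (ϑc : ℝ) :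
    CoolShadowLinearChartObliqueP ϑc (1 / 10) 8 4 12 16 (17 / 20) (1 / 10000) 5 (1 / 10000) 10 (43 / 2) 1 2 (1 / 16) (1 / 50)
        (82 / 5) (821 / 50) (1 / 100) ↔
      CoolShadowLinearChartSkewP ϑc (1 / 10) 8 4 12 16 (17 / 20) (1 / 10000) 5 (1 / 10000) 10 (43 / 2) 1 2 (1 / 16) (1 / 50)
        (82 / 5) (821 / 50) (1 / 100) :=
  ⟨skew_of_oblique, oblique_of_parallel_skew (coolShadowLinearChart_parallel_record ϑc)⟩

end Summit.AtomisticToContinuum.Crystallization.Theorems.ChartedZeroExcessLayeredLatticeLiouville
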